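import Mathlib
import Summits.KontsevichZagierPeriods.KontsevichZagierPeriods.Theorems.SoloInformedNashSymbol
import Summits.KontsevichZagierPeriods.KontsevichZagierPeriods.Theorems.SoloInformedVolumeLadder
import Literature.NumberTheory.Transcendental.CurvePeriodsAffineLineProofs
import HarnessLib

/-!
# Solo-informed: Rung 2 of the volume ladder from Huber–Wüstholz — the assembly

Session s9 of the soloist line `solo-KontsevichZagierPeriods-informed` (file C of the Rung-2 plan,
`paper/rung2-v2.md` §6). Two interface statements and the deciding theorem:

* `SoloInformedPlanarPieces` — every compact `ℚ`-semialgebraic planar region `K` (with the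
  integrand `1`) is KZ-equivalent to a signed sum `Σ εᵢ κ̃(σᵢ).fst` of real parts of Huber–Wüstholz
  period symbols `σᵢ` with NASH paths, with `area(K) = Σ εᵢ ∫_{σᵢ}` (cylindrical decomposition,
  Newton–Leibniz along the fibres, minimal polynomials of the Nash boundary arcs, and endpoint
  resolution by the Puiseux étale shift; §2–3 of the paper);
* `SoloInformedKappaKills` — there is a functional `κ : PeriodSymbol → V` agreeing with `κ̃` on
  symbols with Nash paths and killing every elementary relation (R1)–(R5) with algebraic
  coefficients (Nash replacement of paths + homotopy invariance by KZ–Stokes; §4–5);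
* `soloInformed_volumeRung_two_of` — **`PlanarPieces → KappaKills → HuberWustholzCurvePeriods →
  SoloInformedVolumeRung 2`**: equal areas give a vanishing `ℚ̄`-linear combination of periods of
  curve type; by Huber–Wüstholz (Thm. 13.3 (2)) it is a `ℚ̄`-combination of elementary relations;
  applying `κ` (after descending the coefficients to `ℚ̄`, over which `V` is a module) and taking
  first components gives `⟦[K, 1]⟧ = ⟦[K′, 1]⟧` in the formal period ring, i.e. KZ-equivalence.

References: Huber–Wüstholz 2022, Thm. 13.3 (2) [HuberWuestholz2022]; Kontsevich–Zagier 2001, §1.2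
[KontsevichZagier2001]; Cresson–Viu-Sos, JTNB 2022 (arXiv:1912.01751), Problem 2.1 (the volume form
of the period conjecture, open in every dimension) [CressonViuSos2022].
-/

noncomputable section

open MeasureTheory Set MvPolynomial
open Literature.NumberTheory.Transcendental Literature.NumberTheory.Transcendental.KZ
open Literature.NumberTheory.Transcendental.CurvePeriods
open Literature.ModelTheory.ExponentialFields

namespace Summit.KontsevichZagierPeriods.KontsevichZagierPeriods.Theorems

/-! ## 1. Combinations with complex-algebraic coefficients -/

/-- A combination with coefficients in `F_ℂ = ℚ̄`, viewed with complex coefficients. -/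
def soloInformedCoeFinsupp (ρ : PeriodSymbol →₀ SoloInformedCxAlg) : PeriodSymbol →₀ ℂ :=
  Finsupp.mapRange (fun a : SoloInformedCxAlg => (a : ℂ)) rfl ρ

/-- Pointwise: the complex coefficient is the coercion of the algebraic one. -/
@[simp] theorem soloInformedCoeFinsupp_apply (ρ : PeriodSymbol →₀ SoloInformedCxAlg) (s : PeriodSymbol) :
    soloInformedCoeFinsupp ρ s = (ρ s : ℂ) := Finsupp.mapRange_apply

/-- `soloInformedCoeFinsupp` is additive. -/
theorem soloInformedCoeFinsupp_add (ρ ρ' : PeriodSymbol →₀ SoloInformedCxAlg) :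
    soloInformedCoeFinsupp (ρ + ρ') = soloInformedCoeFinsupp ρ + soloInformedCoeFinsupp ρ' := by
  ext s; simp

/-- `soloInformedCoeFinsupp` commutes with algebraic scalars. -/
theorem soloInformedCoeFinsupp_smul (a : SoloInformedCxAlg) (ρ : PeriodSymbol →₀ SoloInformedCxAlg) :
    soloInformedCoeFinsupp (a • ρ) = (a : ℂ) • soloInformedCoeFinsupp ρ := by
  ext s; simp

/-- `soloInformedCoeFinsupp` commutes with finite sums. -/
theorem soloInformedCoeFinsupp_sum {ι : Type*} (T : Finset ι) (ρ : ι → PeriodSymbol →₀ SoloInformedCxAlg) :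
    soloInformedCoeFinsupp (∑ l ∈ T, ρ l) = ∑ l ∈ T, soloInformedCoeFinsupp (ρ l) := by
  ext s; simp [soloInformedCoeFinsupp]

/-- `soloInformedCoeFinsupp` is injective. -/
theorem soloInformedCoeFinsupp_injective : Function.Injective soloInformedCoeFinsupp := by
  intro ρ ρ' h
  ext s
  have := congrArg (fun c => c s) h
  simpa using this

/-- **Lift** of a complex combination all of whose coefficients are algebraic. -/
def soloInformedLiftFinsupp (c : PeriodSymbol →₀ ℂ) (hc : ∀ s, IsAlgebraic ℚ (c s)) :
    PeriodSymbol →₀ SoloInformedCxAlg where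
  support := c.support
  toFun s := ⟨c s, mem_algebraicClosure_iff.mpr (hc s)⟩
  mem_support_toFun s := by
    rw [Finsupp.mem_support_iff, ne_eq, ne_eq, Subtype.ext_iff]
    rfl

/-- The lift maps back to the original combination. -/
@[simp] theorem soloInformedCoeFinsupp_lift (c : PeriodSymbol →₀ ℂ) (hc : ∀ s, IsAlgebraic ℚ (c s)) :
    soloInformedCoeFinsupp (soloInformedLiftFinsupp c hc) = c := by
  ext s; rfl

/-! ## 2. Elementary relations have algebraic coefficients -/

/-- A `single` with algebraic coefficient has algebraic coefficients. -/
theorem soloInformed_isAlgebraic_single {σ : PeriodSymbol} {a : ℂ} (ha : IsAlgebraic ℚ a)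
    (s : PeriodSymbol) : IsAlgebraic ℚ (Finsupp.single σ a s) := by
  classical
  rw [Finsupp.single_apply]
  split_ifs
  · exact ha
  · exact isAlgebraic_zero

/-! ## 2b. The imaginary component of `κ̃` evaluates to `Im ∫_γ ω` -/

/-- The value of `[[0,1], Im(ω(γ)γ′)]` is `Im ∫_γ ω` (companion of `soloInformedPathRepRe_value`). -/
theorem soloInformedPathRepIm_value (s : PeriodSymbol) (h : SoloInformedIsNashPath s.γ.toFun) :
    (soloInformedPathRepIm s h).value = s.period.im := by
  have hmp : MeasurePreserving (MeasurableEquiv.funUnique (Fin 1) ℝ) volume volume :=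
    volume_preserving_funUnique (Fin 1) ℝ
  have h1 : (soloInformedPathRepIm s h).value =
      ∫ t in Icc (0 : ℝ) 1, (soloInformedPathIntegrand s t).im := by
    show ∫ u in soloInformedUnitI, (soloInformedPathIntegrand s (u 0)).im = _
    rw [soloInformedUnitI_eq_preimage]
    exact hmp.setIntegral_preimage_emb (MeasurableEquiv.funUnique (Fin 1) ℝ).measurableEmbedding
      (fun t => (soloInformedPathIntegrand s t).im) (Icc (0 : ℝ) 1)
  obtain ⟨ε, hε, hd, hsa⟩ := h
  have hε' : (0 : ℝ) < ε := by exact_mod_cast hε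
  have hcont : ContinuousOn (soloInformedPathIntegrand s) (Icc 0 1) :=
    (soloInformed_continuousOn_pathIntegrand s hd).mono fun t ht =>
      ⟨by linarith [ht.1], by linarith [ht.2]⟩
  have hint : IntegrableOn (soloInformedPathIntegrand s) (Ioc 0 1) :=
    hcont.integrableOn_Icc.mono_set Ioc_subset_Icc_self
  rw [h1, integral_Icc_eq_integral_Ioc, soloInformed_period_eq,
    intervalIntegral.integral_of_le zero_le_one]
  have h2 := integral_im hint
  simpa using h2

/-- **`evalP (κ̃ s).snd = Im ∫_γ ω`.** -/
theorem soloInformed_evalP_kappaTilde_snd (s : PeriodSymbol) (h : SoloInformedIsNashPath s.γ.toFun) :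
    evalP (soloInformedKappaTilde s h).snd = s.period.im := by
  rw [soloInformedKappaTilde_snd, evalP_toFormalPeriod_of, soloInformedPathRepIm_value]

/-- `evalP` of the first component of an integer multiple of `κ̃`. -/
theorem soloInformed_evalP_fst_zsmul_kappaTilde (n : ℤ) (s : PeriodSymbol)
    (h : SoloInformedIsNashPath s.γ.toFun) :
    evalP (n • soloInformedKappaTilde s h).fst = n * s.period.re := by
  rw [SoloInformedV.fst_zsmul, map_zsmul, soloInformed_evalP_kappaTilde_fst, zsmul_eq_mul]

/-- `evalP` of the second component of an integer multiple of `κ̃`. -/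
theorem soloInformed_evalP_snd_zsmul_kappaTilde (n : ℤ) (s : PeriodSymbol)
    (h : SoloInformedIsNashPath s.γ.toFun) :
    evalP (n • soloInformedKappaTilde s h).snd = n * s.period.im := by
  rw [SoloInformedV.snd_zsmul, map_zsmul, soloInformed_evalP_kappaTilde_snd, zsmul_eq_mul]

/-- **From the `V`-decomposition to the value identity**: if `(⟦[r]⟧, 0) = Σ εᵢ κ̃(σᵢ)` in `V`, then
`∫ r = Σ εᵢ ∫_{σᵢ}` as complex numbers (apply `evalP` to both components). -/
theorem soloInformed_value_of_pieces {n : ℕ} {r : IntegralRep n} {k : ℕ} {σ : Fin k → PeriodSymbol}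
    {ε : Fin k → ℤ} (hN : ∀ i, SoloInformedIsNashPath (σ i).γ.toFun)
    (h : SoloInformedV.mk (toFormalPeriod (of r)) 0 = ∑ i, ε i • soloInformedKappaTilde (σ i) (hN i)) :
    (r.value : ℂ) = ∑ i, (ε i : ℂ) * (σ i).period := by
  have hfst : evalP (SoloInformedV.mk (toFormalPeriod (of r)) 0).fst =
      evalP (∑ i, ε i • soloInformedKappaTilde (σ i) (hN i)).fst := by rw [h]
  have hsnd : evalP (SoloInformedV.mk (toFormalPeriod (of r)) 0).snd =
      evalP (∑ i, ε i • soloInformedKappaTilde (σ i) (hN i)).snd := by rw [h]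
  rw [SoloInformedV.fst_mk, evalP_toFormalPeriod_of, SoloInformedV.fst_sum, map_sum] at hfst
  rw [SoloInformedV.snd_mk, map_zero, SoloInformedV.snd_sum, map_sum] at hsnd
  simp_rw [soloInformed_evalP_fst_zsmul_kappaTilde] at hfst
  simp_rw [soloInformed_evalP_snd_zsmul_kappaTilde] at hsnd
  apply Complex.ext
  · rw [Complex.ofReal_re, Complex.re_sum]
    refine hfst.trans (Finset.sum_congr rfl fun i _ => ?_)
    simp [Complex.mul_re]
  · rw [Complex.ofReal_im, Complex.im_sum]
    refine hsnd.trans (Finset.sum_congr rfl fun i _ => ?_)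
    simp [Complex.mul_im]

/-! ## 3. The two interface statements -/

/-- **PlanarPieces** (target of files D–F of the plan): every compact `ℚ`-semialgebraic planar
region with the integrand `1` decomposes in `V = P × P` (`P` the formal period ring) as a signed
sum of the values `κ̃(σᵢ) = (⟦[[0,1], Re(ωᵢ(γᵢ)γᵢ′)]⟧, ⟦[[0,1], Im(ωᵢ(γᵢ)γᵢ′)]⟧)` of
Huber–Wüstholz period symbols with Nash paths: `(⟦[K, 1]⟧, 0) = Σ εᵢ κ̃(σᵢ)`. Evaluating
(`KZ.evalP`) gives `area(K) = Σ εᵢ ∫_{σᵢ}` (`soloInformed_value_of_pieces`). [paper/rung2-v2.md, §2–3] -/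
def SoloInformedPlanarPieces : Prop :=
  ∀ r : IntegralRep 2, IsCompact r.domain → (interior r.domain).Nonempty →
    (∀ x ∈ r.domain, r.integrand x = 1) →
    ∃ (k : ℕ) (σ : Fin k → PeriodSymbol) (ε : Fin k → ℤ)
      (hN : ∀ i, SoloInformedIsNashPath (σ i).γ.toFun),
      SoloInformedV.mk (toFormalPeriod (of r)) 0 = ∑ i, ε i • soloInformedKappaTilde (σ i) (hN i)

/-- **KappaKills** (target of files G–J of the plan): a `V`-valued functional on all period symbols
which agrees with `κ̃` on symbols with Nash paths and vanishes, `ℚ̄`-linearly extended, on every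
elementary relation with algebraic coefficients. [paper/rung2-v2.md, §4–5] -/
def SoloInformedKappaKills : Prop :=
  ∃ κ : PeriodSymbol → SoloInformedV,
    (∀ (s : PeriodSymbol) (h : SoloInformedIsNashPath s.γ.toFun), κ s = soloInformedKappaTilde s h) ∧
    ∀ ρ : PeriodSymbol →₀ SoloInformedCxAlg, IsElementaryRelation (soloInformedCoeFinsupp ρ) →
      Finsupp.linearCombination SoloInformedCxAlg κ ρ = 0

/-! ## 4. The assembly -/

/-- The signed combination of the symbols of a planar decomposition, with coefficients in `ℚ̄`. -/
def soloInformedPiecesComb {k : ℕ} (σ : Fin k → PeriodSymbol) (ε : Fin k → ℤ) :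
    PeriodSymbol →₀ SoloInformedCxAlg :=
  ∑ i, Finsupp.single (σ i) ((ε i : ℤ) : SoloInformedCxAlg)

/-- Evaluation of the pieces combination: `Σ εᵢ ∫_{σᵢ}`. -/
theorem soloInformed_evalCombination_piecesComb {k : ℕ} (σ : Fin k → PeriodSymbol) (ε : Fin k → ℤ) :
    evalCombination (soloInformedCoeFinsupp (soloInformedPiecesComb σ ε)) =
      ∑ i, (ε i : ℂ) * (σ i).period := by
  unfold soloInformedPiecesComb
  rw [soloInformedCoeFinsupp_sum]
  have hadd : ∀ (T : Finset (Fin k)),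
      evalCombination (∑ i ∈ T, soloInformedCoeFinsupp (Finsupp.single (σ i) ((ε i : ℤ) : SoloInformedCxAlg)))
        = ∑ i ∈ T, (ε i : ℂ) * (σ i).period := by
    intro T
    classical
    induction T using Finset.induction_on with
    | empty => simp [evalCombination]
    | insert a T ha ih =>
      rw [Finset.sum_insert ha, Finset.sum_insert ha, evalCombination_add, ih]
      congr 1
      have : soloInformedCoeFinsupp (Finsupp.single (σ a) ((ε a : ℤ) : SoloInformedCxAlg)) =
          Finsupp.single (σ a) (ε a : ℂ) := by
        ext s
        classical
        simp [Finsupp.single_apply]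
        split_ifs <;> simp
      rw [this, evalCombination_single]
  exact hadd Finset.univ

/-- `κ` applied to the pieces combination: `Σ εᵢ • κ̃(σᵢ)` (on Nash paths `κ = κ̃`, and integer
scalars act as integer multiples). -/
theorem soloInformed_linearCombination_piecesComb {k : ℕ} (σ : Fin k → PeriodSymbol) (ε : Fin k → ℤ)
    (κ : PeriodSymbol → SoloInformedV) (hN : ∀ i, SoloInformedIsNashPath (σ i).γ.toFun)
    (hκ : ∀ (s : PeriodSymbol) (h : SoloInformedIsNashPath s.γ.toFun), κ s = soloInformedKappaTilde s h) :
    Finsupp.linearCombination SoloInformedCxAlg κ (soloInformedPiecesComb σ ε) =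
      ∑ i, ε i • soloInformedKappaTilde (σ i) (hN i) := by
  unfold soloInformedPiecesComb
  rw [map_sum]
  refine Finset.sum_congr rfl fun i _ => ?_
  rw [Finsupp.linearCombination_single, hκ (σ i) (hN i), SoloInformedV.intCast_smul]

/-- **Rung 2 of the volume ladder from Huber–Wüstholz.** If every compact planar region decomposes
into Nash period symbols (`SoloInformedPlanarPieces`) and the functional `κ` kills the elementary
relations (`SoloInformedKappaKills`), then Huber–Wüstholz's theorem on linear relations of 1-periods
implies the Kontsevich–Zagier period conjecture for areas of compact planar `ℚ`-semialgebraic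
regions: equal areas ⇒ KZ-equivalent. [Huber–Wüstholz 2022, Thm. 13.3 (2); paper/rung2-v2.md §6] -/
theorem soloInformed_volumeRung_two_of (hP : SoloInformedPlanarPieces) (hK : SoloInformedKappaKills)
    (hHW : HuberWustholzCurvePeriods) : SoloInformedVolumeRung 2 := by
  intro r r' hrc hri hr'c hr'i hr1 hr'1 hval
  obtain ⟨k, σ, ε, hN, hrep⟩ := hP r hrc hri hr1
  obtain ⟨k', σ', ε', hN', hrep'⟩ := hP r' hr'c hr'i hr'1
  have hv := soloInformed_value_of_pieces hN hrep
  have hv' := soloInformed_value_of_pieces hN' hrep'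
  obtain ⟨κ, hκ, hkill⟩ := hK
  -- the combination and its evaluation
  set c0 : PeriodSymbol →₀ SoloInformedCxAlg :=
    soloInformedPiecesComb σ ε - soloInformedPiecesComb σ' ε' with hc0
  have halg : ∀ s, IsAlgebraic ℚ (soloInformedCoeFinsupp c0 s) := fun s => by
    rw [soloInformedCoeFinsupp_apply]; exact (c0 s).isAlgebraic
  have heval : evalCombination (soloInformedCoeFinsupp c0) = 0 := by
    have e : soloInformedCoeFinsupp c0 = soloInformedCoeFinsupp (soloInformedPiecesComb σ ε) +
        (-1 : ℂ) • soloInformedCoeFinsupp (soloInformedPiecesComb σ' ε') := by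
      rw [hc0, sub_eq_add_neg, soloInformedCoeFinsupp_add]
      congr 1
      ext s; simp
    rw [e, evalCombination_add, evalCombination_smul, soloInformed_evalCombination_piecesComb,
      soloInformed_evalCombination_piecesComb, ← hv, ← hv', hval]
    ring
  -- Huber–Wüstholz
  obtain ⟨m, ρ, a, hρ, ha, hsum⟩ := hHW _ halg heval
  -- descend the coefficients to ℚ̄
  -- the coefficients of the elementary relations (R1)–(R5) are algebraic
  have hcoef : ∀ {σ : PeriodSymbol →₀ ℂ}, IsElementaryRelation σ →
      ∀ s : PeriodSymbol, IsAlgebraic ℚ (σ s) := by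
    intro σ hσ s
    cases hσ with
    | add Z hZ γ ω ω₁ ω₂ h h₁ h₂ hω =>
      simp only [Finsupp.coe_sub, Pi.sub_apply]
      exact ((soloInformed_isAlgebraic_single isAlgebraic_one s).sub
        (soloInformed_isAlgebraic_single isAlgebraic_one s)).sub
        (soloInformed_isAlgebraic_single isAlgebraic_one s)
    | smul Z hZ γ a ha ω ω' h h' hω =>
      simp only [Finsupp.coe_sub, Finsupp.coe_smul, Pi.sub_apply, Pi.smul_apply, smul_eq_mul]
      exact (soloInformed_isAlgebraic_single isAlgebraic_one s).sub
        (ha.mul (soloInformed_isAlgebraic_single isAlgebraic_one s))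
    | vanish Z hZ γ ω h hv => exact soloInformed_isAlgebraic_single isAlgebraic_one s
    | exact Z hZ γ P hP ω h hω =>
      simp only [Finsupp.coe_sub, Finsupp.coe_smul, Pi.sub_apply, Pi.smul_apply, smul_eq_mul]
      refine (soloInformed_isAlgebraic_single isAlgebraic_one s).sub (IsAlgebraic.mul ?_
        (soloInformed_isAlgebraic_single isAlgebraic_one s))
      exact (hP.isAlgebraic_eval γ.algebraic_one).sub (hP.isAlgebraic_eval γ.algebraic_zero)
    | pushforward Z Z' hZ hZ' f hf hfZ ω' h' ω h hω γ γ' hγ' =>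
      simp only [Finsupp.coe_sub, Pi.sub_apply]
      exact (soloInformed_isAlgebraic_single isAlgebraic_one s).sub
        (soloInformed_isAlgebraic_single isAlgebraic_one s)
    | boundary Z hZ ω h τ hτ hτZ e₀₁ e₁₂ e₀₂ h₀₁ h₁₂ h₀₂ =>
      simp only [Finsupp.coe_sub, Finsupp.coe_add, Pi.sub_apply, Pi.add_apply]
      exact ((soloInformed_isAlgebraic_single isAlgebraic_one s).add
        (soloInformed_isAlgebraic_single isAlgebraic_one s)).sub
        (soloInformed_isAlgebraic_single isAlgebraic_one s)
  let ρ0 : Fin m → PeriodSymbol →₀ SoloInformedCxAlg := fun l =>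
    soloInformedLiftFinsupp (ρ l) (hcoef (hρ l))
  let a0 : Fin m → SoloInformedCxAlg := fun l => ⟨a l, mem_algebraicClosure_iff.mpr (ha l)⟩
  have hdesc : c0 = ∑ l, a0 l • ρ0 l := by
    apply soloInformedCoeFinsupp_injective
    rw [hsum, soloInformedCoeFinsupp_sum]
    refine Finset.sum_congr rfl fun l _ => ?_
    rw [soloInformedCoeFinsupp_smul, soloInformedCoeFinsupp_lift]
  -- apply κ
  have hK0 : Finsupp.linearCombination SoloInformedCxAlg κ c0 = 0 := by
    rw [hdesc, map_sum]
    refine Finset.sum_eq_zero fun l _ => ?_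
    rw [map_smul, hkill (ρ0 l) (by rw [soloInformedCoeFinsupp_lift]; exact hρ l), smul_zero]
  rw [hc0, map_sub, soloInformed_linearCombination_piecesComb σ ε κ hN hκ,
    soloInformed_linearCombination_piecesComb σ' ε' κ hN' hκ, sub_eq_zero] at hK0
  -- first components
  rw [← hrep, ← hrep'] at hK0
  have hfst := congrArg SoloInformedV.fst hK0
  simp only [SoloInformedV.fst_mk] at hfst
  -- conclude
  change of r - of r' ∈ relations
  rw [← toFormalPeriod_eq_zero_iff, map_sub, sub_eq_zero]
  exact hfst

/-- **Rungs `≤ 2` from Huber–Wüstholz** (monotonicity of the ladder, `soloInformedVolumeRung_of_le`). -/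
theorem soloInformed_volumeRung_le_two_of (hP : SoloInformedPlanarPieces) (hK : SoloInformedKappaKills)
    (hHW : HuberWustholzCurvePeriods) {d : ℕ} (hd : d ≤ 2) : SoloInformedVolumeRung d :=
  soloInformedVolumeRung_of_le hd (soloInformed_volumeRung_two_of hP hK hHW)

end Summit.KontsevichZagierPeriods.KontsevichZagierPeriods.Theorems
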